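import Mathlib
import Summits.ValiantsHypothesis.ValiantsHypothesis.Theorems.FifoMatchingNNLowDegreeCofactorHardCofactorBuysVertices
import HarnessLib

/-!
# Route `FifoMatching`, item `NNDivisionHard` (stmt-ValiantsHypothesis-21181): prescribing the
# internal part of the matchings — the cofactor-free face `AV_{R,S}` of `NN_n · p`

Helper toward `NNDivisionHard` (cofactors of ARBITRARY degree), landed `--supports`; it is the typed
door N3 / recommendation R1 of the memo `Cruxes/NNLinearDegreeCofactorHard/Lines/internal_cofactor-NEXT-RUNG-dual.md`
(val-idea-7 g5, LENS dual) and discharges, by name, the only stub `stub_prescribedInternalFace` of the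
workfile `Cruxes/NNLinearDegreeCofactorHard/Lines/next_rung_dual.lean` (the final theorem below has
literally the stub's signature with `prescribedFamilyPoly` / `internalArcs` unfolded).

**Statement.**  Let `p ≠ 0` be an INTERNAL cofactor on a vertex set `R ⊆ [2n]` (every arc variable
of every monomial of `p` has both endpoints in `R`) and let `S` be any arc set realised as the set of
`R`-internal arcs of some nest-free perfect matching of `[2n]`.  Then for some `β ≠ 0`
`L₊(AV_{R,S} · β) ≤ L₊(NN_n · p)`, where `AV_{R,S} = Σ_{M nest-free, int_R(M) = S} x^{M ∖ (R × R)}` is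
the 0/1 polynomial of the nest-free perfect matchings whose `R`-internal arc set is EXACTLY `S`, with
the internal (prescribed) arcs erased (`complexity_prescribedFamily_mul_C_le`); hence also
`L₊(AV_{R,S}) ≤ L₊(NN_n · p) + 1` (`complexity_prescribedFamily_le_succ`).  No hypothesis `|R| ≤ n`,
no degree hypothesis on `p`.  The case `S = ∅` is the tree's `KillCofactor.complexity_family_mul_C_le`
(the avoiding family `𝓕_R`, empty as soon as `|R| > n`); `S ≠ ∅` is available for every `R`.

**Proof** (the two free moves of `KillCofactor`, with a new weight).  Grade the arc variables by the
`ℕ`-weight `W_S(e) = K·[e ∈ S] + [e ∉ R × R]` with `K = |S| + 1`.  For a perfect matching `M` with `a`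
arcs in `S` and `b` internal arcs, `W_S(x^M) = K a + (n - b)`; since `S ⊆ R × R` one has `a ≤ b` and
`a ≤ |S|`, so `W_S(x^M) ≤ K|S| + n - |S|` with equality iff `a = b = |S|` iff `int_R(M) = S`
(`weight_add_card_le`).  Hence the top `W_S`-component of `NN_n` is `Σ_{int_R(M) = S} x^M`
(`topComponent_nn_eq_sum`), that of `p` is a nonzero internal `p'`, top components are multiplicative
and free over `ℝ≥0` (`topComponent_mul`, `complexity_topComponent_le`), and the free substitution
`x_e ↦ 1` on `R × R` sends `Σ_{int_R(M) = S} x^M` to `AV_{R,S}` and `p'` to the constant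
`β = Σ coeff p' ≠ 0`.

Honest framing: a helper (face reduction) for an OPEN item of a CONDITIONAL route; it proves no route
item, constructs no measure on the prescribed families, and says nothing about `NNNotVP` or VP ≠ VNP
(NOT proved); monotone world only (`Literature.Barriers.ValiantsHypothesis.MonotoneGap`).  No
definitions (the family, the arc set and the weight are inlined / passed with defining hypotheses),
no named facts. [folklore tools; the prescribed-`S` face is the memo's N3]
-/

noncomputable section

-- Sub = Summit single-conjunct layout: the duplicated namespace component is mandated by the tree.
set_option linter.dupNamespace false

namespace Summit.ValiantsHypothesis.ValiantsHypothesis.Theorems.FifoMatching.NNDivisionHard.PrescribedInternal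

open MvPolynomial Finset Literature.Computability.AlgebraicComplexity
open Summit.ValiantsHypothesis.ValiantsHypothesis.Theorems.ZeroOneTransfer.Negative
open Summit.ValiantsHypothesis.ValiantsHypothesis.Theorems.FifoMatching.NNLowDegreeCofactorHard
open scoped NNReal

variable {m : ℕ}

/-! ### Internal arcs of a matching relative to a vertex set `R` -/

/-- The arc map `i ↦ (i, M i)` is injective. [folklore] -/
theorem arcMap_injective (M : Fin m → Fin m) : Function.Injective fun i : Fin m => (i, M i) :=
  fun _ _ h => (Prod.ext_iff.1 h).1

/-- The internal openers of `M` (openers `i` with `i, M i ∈ R`) are the points `i < M i` with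
`i, M i ∈ R`. [folklore] -/
theorem filter_openers_internal (R : Finset (Fin m)) (M : Fin m → Fin m) :
    (openers M).filter (fun i => i ∈ R ∧ M i ∈ R)
      = univ.filter fun i : Fin m => i < M i ∧ i ∈ R ∧ M i ∈ R := by
  rw [openers, filter_filter]

/-- The number of `R`-internal arcs of `M` is the number of its internal openers. [folklore] -/
theorem card_internalArcs (R : Finset (Fin m)) (M : Fin m → Fin m) :
    ((univ.filter fun i : Fin m => i < M i ∧ i ∈ R ∧ M i ∈ R).image fun i => (i, M i)).card
      = ((openers M).filter fun i => i ∈ R ∧ M i ∈ R).card := by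
  rw [card_image_of_injective _ (arcMap_injective M), filter_openers_internal]

/-- An `R`-internal arc has both endpoints in `R`. [folklore] -/
theorem internal_of_mem_internalArcs (R : Finset (Fin m)) (M : Fin m → Fin m)
    {e : Fin m × Fin m}
    (he : e ∈ (univ.filter fun i : Fin m => i < M i ∧ i ∈ R ∧ M i ∈ R).image fun i => (i, M i)) :
    e.1 ∈ R ∧ e.2 ∈ R := by
  rw [mem_image] at he
  obtain ⟨i, hi, rfl⟩ := he
  rw [mem_filter] at hi
  exact ⟨hi.2.2.1, hi.2.2.2⟩

/-- The openers of `M` whose arc lies in `S` inject into `S`: there are at most `|S|` of them.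
[folklore] -/
theorem card_filter_arc_mem_le (S : Finset (Fin m × Fin m)) (M : Fin m → Fin m) :
    ((openers M).filter fun i => (i, M i) ∈ S).card ≤ S.card := by
  calc ((openers M).filter fun i => (i, M i) ∈ S).card
      = (((openers M).filter fun i => (i, M i) ∈ S).image fun i => (i, M i)).card :=
        (card_image_of_injective _ (arcMap_injective M)).symm
    _ ≤ S.card := by
        refine card_le_card ?_
        intro e he
        rw [mem_image] at he
        obtain ⟨i, hi, rfl⟩ := he
        exact (mem_filter.1 hi).2

/-- If `S ⊆ R × R`, the openers of `M` whose arc lies in `S` are internal openers. [folklore] -/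
theorem filter_arc_mem_subset_internal {R : Finset (Fin m)} {S : Finset (Fin m × Fin m)}
    (hSint : ∀ e ∈ S, e.1 ∈ R ∧ e.2 ∈ R) (M : Fin m → Fin m) :
    (openers M).filter (fun i => (i, M i) ∈ S) ⊆ (openers M).filter (fun i => i ∈ R ∧ M i ∈ R) := by
  intro i hi
  rw [mem_filter] at hi ⊢
  exact ⟨hi.1, hSint _ hi.2⟩

/-- **The internal arc set of `M` is exactly `S`** iff `M` has `|S|` arcs in `S` and `|S|` internal
arcs (for `S ⊆ R × R`). [folklore] -/
theorem internalArcs_eq_iff {R : Finset (Fin m)} {S : Finset (Fin m × Fin m)}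
    (hSint : ∀ e ∈ S, e.1 ∈ R ∧ e.2 ∈ R) (M : Fin m → Fin m) :
    ((univ.filter fun i : Fin m => i < M i ∧ i ∈ R ∧ M i ∈ R).image fun i => (i, M i)) = S ↔
      ((openers M).filter fun i => (i, M i) ∈ S).card = S.card ∧
        ((openers M).filter fun i => i ∈ R ∧ M i ∈ R).card = S.card := by
  have hsub := filter_arc_mem_subset_internal hSint M
  have haS := card_filter_arc_mem_le S M
  constructor
  · intro h
    have hb : ((openers M).filter fun i => i ∈ R ∧ M i ∈ R).card = S.card := by
      rw [← card_internalArcs, h]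
    refine ⟨le_antisymm haS ?_, hb⟩
    rw [← hb]
    refine card_le_card fun i hi => ?_
    rw [mem_filter] at hi ⊢
    refine ⟨hi.1, ?_⟩
    rw [← h, mem_image]
    exact ⟨i, by rw [← filter_openers_internal, mem_filter]; exact hi, rfl⟩
  · rintro ⟨ha, hb⟩
    have heq : (openers M).filter (fun i => (i, M i) ∈ S)
        = (openers M).filter (fun i => i ∈ R ∧ M i ∈ R) :=
      eq_of_subset_of_card_le hsub (by rw [ha, hb])
    have himg : ((openers M).filter fun i => (i, M i) ∈ S).image (fun i => (i, M i)) = S := by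
      refine eq_of_subset_of_card_le ?_ ?_
      · intro e he
        rw [mem_image] at he
        obtain ⟨i, hi, rfl⟩ := he
        exact (mem_filter.1 hi).2
      · rw [card_image_of_injective _ (arcMap_injective M), ha]
    rw [← filter_openers_internal, ← heq, himg]

/-! ### The weight `W_S = K·[e ∈ S] + [e ∉ R × R]` of the arc set of a matching -/

/-- The `W_S`-weight of the arc set of `M` is `K·#{arcs in S} + #{arcs not inside R × R}`.
[folklore] -/
theorem weight_arcExponent (R : Finset (Fin m)) (S : Finset (Fin m × Fin m)) (K : ℕ)
    (W : Fin m × Fin m → ℕ)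
    (hW : ∀ e, W e = (if e ∈ S then K else 0) + (if e.1 ∈ R ∧ e.2 ∈ R then 0 else 1))
    (M : Fin m → Fin m) :
    Finsupp.weight W (arcExponent M)
      = K * ((openers M).filter fun i => (i, M i) ∈ S).card
        + ((openers M).filter fun i => ¬ (i ∈ R ∧ M i ∈ R)).card := by
  rw [arcExponent, map_sum]
  simp_rw [Finsupp.weight_single, smul_eq_mul, one_mul, hW]
  rw [sum_add_distrib, card_filter, card_filter, mul_sum]
  congr 1
  · refine sum_congr rfl fun i _ => ?_
    split_ifs <;> simp
  · refine sum_congr rfl fun i _ => ?_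
    split_ifs <;> simp

/-- **Key inequality.**  For a perfect matching `M` of `[2n]`, `S ⊆ R × R` and `K = |S| + 1`:
`W_S(x^M) + |S| ≤ K|S| + n`, with equality iff the `R`-internal arc set of `M` is exactly `S`.
[folklore] -/
theorem weight_add_card_le {n : ℕ} {R : Finset (Fin (2 * n))}
    {S : Finset (Fin (2 * n) × Fin (2 * n))} (hSint : ∀ e ∈ S, e.1 ∈ R ∧ e.2 ∈ R)
    (W : Fin (2 * n) × Fin (2 * n) → ℕ)
    (hW : ∀ e, W e = (if e ∈ S then (S.card + 1) else 0) + (if e.1 ∈ R ∧ e.2 ∈ R then 0 else 1))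
    {M : Fin (2 * n) → Fin (2 * n)} (hM : M ∈ perfectMatchings (2 * n)) :
    Finsupp.weight W (arcExponent M) + S.card ≤ (S.card + 1) * S.card + n ∧
      (Finsupp.weight W (arcExponent M) + S.card = (S.card + 1) * S.card + n ↔
        ((univ.filter fun i : Fin (2 * n) => i < M i ∧ i ∈ R ∧ M i ∈ R).image fun i => (i, M i)) = S) := by
  rw [weight_arcExponent R S (S.card + 1) W hW M, internalArcs_eq_iff hSint M]
  set a := ((openers M).filter fun i => (i, M i) ∈ S).card with ha
  set b := ((openers M).filter fun i => i ∈ R ∧ M i ∈ R).card with hb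
  set x := ((openers M).filter fun i => ¬ (i ∈ R ∧ M i ∈ R)).card with hx
  have hab : a ≤ b := card_le_card (filter_arc_mem_subset_internal hSint M)
  have haS : a ≤ S.card := card_filter_arc_mem_le S M
  have hbx : b + x = n := by
    rw [hb, hx, card_filter_add_card_filter_not, card_openers hM]
  set K := S.card + 1 with hK
  -- `K a + K ≤ K |S|` unless `a = |S|`
  rcases Nat.lt_or_ge a S.card with hlt | hge
  · have h1 : K * a + K ≤ K * S.card := by
      rw [← Nat.mul_succ]; exact Nat.mul_le_mul_left K hlt
    refine ⟨by omega, ⟨fun h => ?_, fun h => ?_⟩⟩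
    · exfalso; omega
    · omega
  · have haeq : a = S.card := le_antisymm haS hge
    refine ⟨by rw [haeq]; omega, ⟨fun h => ⟨haeq, ?_⟩, fun h => ?_⟩⟩
    · rw [haeq] at h; omega
    · rw [haeq]; omega

/-! ### The top `W_S`-component of `NN_n` is the prescribed family -/

/-- The `W_S`-weighted total degree of `NN_n` is `K|S| + n - |S|`, attained exactly at the
nest-free perfect matchings with internal arc set `S` (one exists by hypothesis). [folklore] -/
theorem weightedTotalDegree_nn_add_card {n : ℕ} {R : Finset (Fin (2 * n))}
    {S : Finset (Fin (2 * n) × Fin (2 * n))}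
    (hS : ∃ M ∈ nestFreeMatchings (2 * n),
      ((univ.filter fun i : Fin (2 * n) => i < M i ∧ i ∈ R ∧ M i ∈ R).image fun i => (i, M i)) = S)
    (W : Fin (2 * n) × Fin (2 * n) → ℕ)
    (hW : ∀ e, W e = (if e ∈ S then (S.card + 1) else 0) + (if e.1 ∈ R ∧ e.2 ∈ R then 0 else 1)) :
    weightedTotalDegree W (nestFreeMatchingPoly n ℝ≥0) + S.card = (S.card + 1) * S.card + n := by
  obtain ⟨M₀, hM₀, hM₀S⟩ := hS
  have hSint : ∀ e ∈ S, e.1 ∈ R ∧ e.2 ∈ R := fun e he =>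
    internal_of_mem_internalArcs R M₀ (by rw [hM₀S]; exact he)
  have h₀ := weight_add_card_le hSint W hW (nestFreeMatchings_subset_perfectMatchings hM₀)
  have h₀eq := h₀.2.2 hM₀S
  apply le_antisymm
  · -- every monomial has weight ≤ the bound
    have : weightedTotalDegree W (nestFreeMatchingPoly n ℝ≥0) ≤ (S.card + 1) * S.card + n - S.card := by
      rw [weightedTotalDegree]
      refine Finset.sup_le fun d hd => ?_
      rw [support_nestFreeMatchingPoly, mem_image] at hd
      obtain ⟨M, hM, rfl⟩ := hd
      have := (weight_add_card_le hSint W hW (nestFreeMatchings_subset_perfectMatchings hM)).1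
      omega
    omega
  · have hle : Finsupp.weight W (arcExponent M₀) ≤ weightedTotalDegree W (nestFreeMatchingPoly n ℝ≥0) := by
      refine le_weightedTotalDegree W ?_
      rw [support_nestFreeMatchingPoly, mem_image]
      exact ⟨M₀, hM₀, rfl⟩
    omega

/-- For a nest-free perfect matching `M`: `x^M` has top `W_S`-weight in `NN_n` iff the internal arc
set of `M` is exactly `S`. [folklore] -/
theorem weight_eq_weightedTotalDegree_iff {n : ℕ} {R : Finset (Fin (2 * n))}
    {S : Finset (Fin (2 * n) × Fin (2 * n))}
    (hS : ∃ M ∈ nestFreeMatchings (2 * n),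
      ((univ.filter fun i : Fin (2 * n) => i < M i ∧ i ∈ R ∧ M i ∈ R).image fun i => (i, M i)) = S)
    (W : Fin (2 * n) × Fin (2 * n) → ℕ)
    (hW : ∀ e, W e = (if e ∈ S then (S.card + 1) else 0) + (if e.1 ∈ R ∧ e.2 ∈ R then 0 else 1))
    {M : Fin (2 * n) → Fin (2 * n)} (hM : M ∈ perfectMatchings (2 * n)) :
    Finsupp.weight W (arcExponent M) = weightedTotalDegree W (nestFreeMatchingPoly n ℝ≥0) ↔
      ((univ.filter fun i : Fin (2 * n) => i < M i ∧ i ∈ R ∧ M i ∈ R).image fun i => (i, M i)) = S := by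
  have hdeg := weightedTotalDegree_nn_add_card hS W hW
  obtain ⟨M₀, hM₀, hM₀S⟩ := hS
  have hSint : ∀ e ∈ S, e.1 ∈ R ∧ e.2 ∈ R := fun e he =>
    internal_of_mem_internalArcs R M₀ (by rw [hM₀S]; exact he)
  have h := weight_add_card_le hSint W hW hM
  rw [← h.2]
  omega

/-- **The top `W_S`-component of `NN_n` is `Σ_{int_R(M) = S} x^M`**, the sum of the arc monomials
of the nest-free perfect matchings of `[2n]` whose `R`-internal arc set is exactly `S`. [folklore] -/
theorem topComponent_nn_eq_sum {n : ℕ} {R : Finset (Fin (2 * n))}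
    {S : Finset (Fin (2 * n) × Fin (2 * n))}
    (hS : ∃ M ∈ nestFreeMatchings (2 * n),
      ((univ.filter fun i : Fin (2 * n) => i < M i ∧ i ∈ R ∧ M i ∈ R).image fun i => (i, M i)) = S)
    (W : Fin (2 * n) × Fin (2 * n) → ℕ)
    (hW : ∀ e, W e = (if e ∈ S then (S.card + 1) else 0) + (if e.1 ∈ R ∧ e.2 ∈ R then 0 else 1)) :
    topComponent W (nestFreeMatchingPoly n ℝ≥0)
      = ∑ M ∈ (nestFreeMatchings (2 * n)).filter (fun M =>
          ((univ.filter fun i : Fin (2 * n) => i < M i ∧ i ∈ R ∧ M i ∈ R).image fun i => (i, M i)) = S),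
        arcMonomial ℝ≥0 M := by
  have hsub : (nestFreeMatchings (2 * n)).filter (fun M =>
      ((univ.filter fun i : Fin (2 * n) => i < M i ∧ i ∈ R ∧ M i ∈ R).image fun i => (i, M i)) = S)
        ⊆ perfectMatchings (2 * n) :=
    (filter_subset _ _).trans nestFreeMatchings_subset_perfectMatchings
  ext d
  rw [coeff_topComponent, nestFreeMatchingPoly_eq_sum_arcMonomial,
    coeff_sum_arcMonomial nestFreeMatchings_subset_perfectMatchings, coeff_sum_arcMonomial hsub,
    ← nestFreeMatchingPoly_eq_sum_arcMonomial]
  by_cases h : ∃ M ∈ (nestFreeMatchings (2 * n)).filter (fun M =>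
      ((univ.filter fun i : Fin (2 * n) => i < M i ∧ i ∈ R ∧ M i ∈ R).image fun i => (i, M i)) = S),
      arcExponent M = d
  · obtain ⟨M, hM, hMd⟩ := h
    have hM' := mem_filter.1 hM
    have hw := (weight_eq_weightedTotalDegree_iff hS W hW
      (nestFreeMatchings_subset_perfectMatchings hM'.1)).2 hM'.2
    rw [hMd] at hw
    rw [if_pos hw, if_pos ⟨M, hM'.1, hMd⟩, if_pos ⟨M, hM, hMd⟩]
  · rw [if_neg h]
    split_ifs with hw hex
    · exfalso
      obtain ⟨M, hM, hMd⟩ := hex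
      apply h
      refine ⟨M, mem_filter.2 ⟨hM, ?_⟩, hMd⟩
      have := weight_eq_weightedTotalDegree_iff hS W hW (M := M)
        (nestFreeMatchings_subset_perfectMatchings hM)
      rw [hMd] at this
      exact this.1 hw
    · rfl
    · rfl

/-! ### Substituting `1` for the `R × R` variables erases the prescribed arcs -/

/-- The substitution `x_e ↦ 1` (`e ∈ R × R`), `x_e ↦ x_e` otherwise, sends `Σ_{int_R(M) = S} x^M` to
`AV_{R,S} = Σ_{int_R(M) = S} x^{M ∖ (R × R)}`. [folklore] -/
theorem aeval_rrOne_prescribedFamily {n : ℕ} (R : Finset (Fin (2 * n)))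
    (𝓕 : Finset (Fin (2 * n) → Fin (2 * n))) :
    aeval (fun e : Fin (2 * n) × Fin (2 * n) =>
        if e.1 ∈ R ∧ e.2 ∈ R then (1 : MvPolynomial (Fin (2 * n) × Fin (2 * n)) ℝ≥0) else X e)
      (∑ M ∈ 𝓕, arcMonomial ℝ≥0 M)
      = ∑ M ∈ 𝓕, ∏ i : Fin (2 * n), if i < M i ∧ ¬ (i ∈ R ∧ M i ∈ R) then X (i, M i) else 1 := by
  rw [map_sum]
  refine sum_congr rfl fun M _ => ?_
  rw [arcMonomial, map_prod]
  refine prod_congr rfl fun i _ => ?_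
  by_cases h1 : i < M i
  · by_cases h2 : i ∈ R ∧ M i ∈ R
    · rw [if_pos h1, aeval_X, if_pos h2, if_neg (fun h => h.2 h2)]
    · rw [if_pos h1, aeval_X, if_neg h2, if_pos ⟨h1, h2⟩]
  · rw [if_neg h1, map_one, if_neg (fun h => h1 h.1)]

/-! ### The face reduction -/

/-- **Prescribing the internal part** (memo N3 / stub `stub_prescribedInternalFace`, signature
literally that of the stub with `prescribedFamilyPoly`, `internalArcs` unfolded).  For `p ≠ 0` internal
on `R` and ANY arc set `S` realised as the `R`-internal arc set of a nest-free perfect matching of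
`[2n]`, there is `β ≠ 0` with `L₊(AV_{R,S} · β) ≤ L₊(NN_n · p)`: top `W_S`-component
(`W_S = (|S|+1)·[e ∈ S] + [e ∉ R × R]`; free and multiplicative over `ℝ≥0`), then `x_e ↦ 1` on
`R × R` (free); `β = Σ coeff (top_{W_S} p)`.  No hypothesis `|R| ≤ n`, no degree hypothesis.
[folklore tools; prescribed-`S` face = memo N3] -/
theorem complexity_prescribedFamily_mul_C_le (n : ℕ) (R : Finset (Fin (2 * n)))
    {p : MvPolynomial (Fin (2 * n) × Fin (2 * n)) ℝ≥0} (hp : p ≠ 0)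
    (hint : ∀ d ∈ p.support, ∀ e ∈ d.support, e.1 ∈ R ∧ e.2 ∈ R)
    (S : Finset (Fin (2 * n) × Fin (2 * n)))
    (hS : ∃ M ∈ nestFreeMatchings (2 * n),
      ((Finset.univ.filter fun i : Fin (2 * n) => i < M i ∧ i ∈ R ∧ M i ∈ R).image
        fun i => (i, M i)) = S) :
    ∃ β : ℝ≥0, β ≠ 0 ∧
      complexity ((∑ M ∈ (nestFreeMatchings (2 * n)).filter (fun M =>
          ((Finset.univ.filter fun i : Fin (2 * n) => i < M i ∧ i ∈ R ∧ M i ∈ R).image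
            fun i => (i, M i)) = S),
        ∏ i : Fin (2 * n), if i < M i ∧ ¬ (i ∈ R ∧ M i ∈ R) then X (i, M i) else 1) * C β)
        ≤ complexity (nestFreeMatchingPoly n ℝ≥0 * p) := by
  set W : Fin (2 * n) × Fin (2 * n) → ℕ := fun e =>
    (if e ∈ S then (S.card + 1) else 0) + (if e.1 ∈ R ∧ e.2 ∈ R then 0 else 1) with hWdef
  have hW : ∀ e, W e = (if e ∈ S then (S.card + 1) else 0) + (if e.1 ∈ R ∧ e.2 ∈ R then 0 else 1) :=
    fun e => rfl
  set φ : Fin (2 * n) × Fin (2 * n) → MvPolynomial (Fin (2 * n) × Fin (2 * n)) ℝ≥0 := fun e =>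
    if e.1 ∈ R ∧ e.2 ∈ R then (1 : MvPolynomial (Fin (2 * n) × Fin (2 * n)) ℝ≥0) else X e with hφ
  -- the top component `p'` of the cofactor: nonzero and internal
  have hp' : topComponent W p ≠ 0 := topComponent_ne_zero W hp
  have hint' : ∀ d ∈ (topComponent W p).support, ∀ e ∈ d.support, e.1 ∈ R ∧ e.2 ∈ R :=
    fun d hd => hint d (support_topComponent_subset W p hd)
  refine ⟨∑ d ∈ (topComponent W p).support, coeff d (topComponent W p), sum_coeff_ne_zero hp', ?_⟩
  have htop : topComponent W (nestFreeMatchingPoly n ℝ≥0 * p)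
      = (∑ M ∈ (nestFreeMatchings (2 * n)).filter (fun M =>
          ((Finset.univ.filter fun i : Fin (2 * n) => i < M i ∧ i ∈ R ∧ M i ∈ R).image
            fun i => (i, M i)) = S), arcMonomial ℝ≥0 M) * topComponent W p := by
    rw [topComponent_mul, topComponent_nn_eq_sum hS W hW]
  have haeval : aeval φ (topComponent W (nestFreeMatchingPoly n ℝ≥0 * p))
      = (∑ M ∈ (nestFreeMatchings (2 * n)).filter (fun M =>
          ((Finset.univ.filter fun i : Fin (2 * n) => i < M i ∧ i ∈ R ∧ M i ∈ R).image
            fun i => (i, M i)) = S),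
          ∏ i : Fin (2 * n), if i < M i ∧ ¬ (i ∈ R ∧ M i ∈ R) then X (i, M i) else 1)
        * C (∑ d ∈ (topComponent W p).support, coeff d (topComponent W p)) := by
    rw [htop, map_mul, aeval_rrOne_prescribedFamily,
      aeval_eq_C_sum_coeff φ (fun d hd e he => if_pos (hint' d hd e he))]
  have hfree : ∀ e, complexity (φ e) = 0 := by
    intro e
    by_cases he : e.1 ∈ R ∧ e.2 ∈ R
    · simp only [hφ, if_pos he]; rw [← C_1]; exact complexity_C_holds _
    · simp only [hφ, if_neg he]; exact complexity_X_holds _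
  rw [← haeval]
  exact (complexity_aeval_le_of_free φ hfree _).trans (complexity_topComponent_le W _)

/-- **Corollary (no constant).**  Under the same hypotheses `L₊(AV_{R,S}) ≤ L₊(NN_n · p) + 1`:
divide by the nonzero constant `β` (one free constant, one product gate). [folklore] -/
theorem complexity_prescribedFamily_le_succ (n : ℕ) (R : Finset (Fin (2 * n)))
    {p : MvPolynomial (Fin (2 * n) × Fin (2 * n)) ℝ≥0} (hp : p ≠ 0)
    (hint : ∀ d ∈ p.support, ∀ e ∈ d.support, e.1 ∈ R ∧ e.2 ∈ R)
    (S : Finset (Fin (2 * n) × Fin (2 * n)))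
    (hS : ∃ M ∈ nestFreeMatchings (2 * n),
      ((Finset.univ.filter fun i : Fin (2 * n) => i < M i ∧ i ∈ R ∧ M i ∈ R).image
        fun i => (i, M i)) = S) :
    complexity (∑ M ∈ (nestFreeMatchings (2 * n)).filter (fun M =>
          ((Finset.univ.filter fun i : Fin (2 * n) => i < M i ∧ i ∈ R ∧ M i ∈ R).image
            fun i => (i, M i)) = S),
        ∏ i : Fin (2 * n), if i < M i ∧ ¬ (i ∈ R ∧ M i ∈ R) then
          (X (i, M i) : MvPolynomial (Fin (2 * n) × Fin (2 * n)) ℝ≥0) else 1)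
      ≤ complexity (nestFreeMatchingPoly n ℝ≥0 * p) + 1 := by
  obtain ⟨β, hβ, hle⟩ := complexity_prescribedFamily_mul_C_le n R hp hint S hS
  set AV := ∑ M ∈ (nestFreeMatchings (2 * n)).filter (fun M =>
          ((Finset.univ.filter fun i : Fin (2 * n) => i < M i ∧ i ∈ R ∧ M i ∈ R).image
            fun i => (i, M i)) = S),
        ∏ i : Fin (2 * n), if i < M i ∧ ¬ (i ∈ R ∧ M i ∈ R) then X (i, M i) else
          (1 : MvPolynomial (Fin (2 * n) × Fin (2 * n)) ℝ≥0) with hAV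
  have hC : (C β : MvPolynomial (Fin (2 * n) × Fin (2 * n)) ℝ≥0) * C β⁻¹ = 1 := by
    rw [← map_mul, mul_inv_cancel₀ hβ, map_one]
  have hAVeq : AV * C β * C β⁻¹ = AV := by rw [mul_assoc, hC, mul_one]
  calc complexity AV = complexity (AV * C β * C β⁻¹) := by rw [hAVeq]
    _ ≤ complexity (AV * C β) + complexity (C β⁻¹ : MvPolynomial (Fin (2 * n) × Fin (2 * n)) ℝ≥0) + 1 :=
        complexity_mul_le_holds _ _
    _ ≤ complexity (nestFreeMatchingPoly n ℝ≥0 * p) + 1 := by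
        rw [complexity_C_holds, add_zero]; exact Nat.add_le_add_right hle 1

end Summit.ValiantsHypothesis.ValiantsHypothesis.Theorems.FifoMatching.NNDivisionHard.PrescribedInternal

end
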